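import Summits.SmoothPoincare4.SmoothPoincare4.Theorems.ConvexBisectionAcyclicBisectionExistsBaseReflectionTwisting
import Literature.Geometry.Symplectic.LefschetzSteinOpenBook
import Literature.Geometry.Manifold.OpenSubmanifoldMFDeriv
import Literature.Topology.FourManifolds.HandleAttachingMapsTransport
import HarnessLib

/-!
# Dual handles, ORSEAM: positive boundary frames of the cap under the fibred reflection
(sub-goal ORSEAM of stub `stub_T3_dualPresentation` (T3), line `modp-braid-orbits` r12, crux
`ConvexBisection.AcyclicBisectionExists`, item stmt-SmoothPoincare4-10508; wave 5, lead c5, worker X4;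
registered sub-goal `helper_isPosBdryFrame_baseReflection`)

T3 clause (iv) (ORSEAM) asks for one seam point at which a frame of `T∂X₁` corresponds to POSITIVELY
oriented boundary frames (`IsPosBdryFrame`: `det4 (∇rho, v₀, v₁, v₂) > 0`, `LefschetzSteinOpenBook.lean`)
of both presentations.  When the complement piece is re-read through V3's fibred involution
`σ = baseReflection g` (the SIGN-PIN, `…DualSignPin.lean`), its boundary frames are pushed by `dσ`; this
file computes the effect on `det4 (∇rho, ·, ·, ·)`:

* §1 `det4` as the determinant form of the standard basis (`det4_eq_basis_det`), hence multilinear and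
  alternating in its first slot and multiplied by `det L` under a linear map `L` (`det4_map`).
* §2 **the linear-algebra core** (`det4_normal_map`): if `L` is a linear automorphism, `n ≠ 0`,
  `⟪n', L u⟫ = ⟪n, u⟫` for all `u` (so `L` maps the hyperplane `n^⊥` onto `n'^⊥`) and `V₀, V₁, V₂ ⊥ n`
  with `det4 (n, V) ≠ 0`, then `det4 (n', LV₀, LV₁, LV₂) = det L · (‖n'‖²/‖n‖²) · det4 (n, V₀, V₁, V₂)`
  (expand `n'` in the basis `(Ln, LV₀, LV₁, LV₂)`; its `Ln`-coefficient is `‖n'‖²/‖n‖²`).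
* §3 **boundary frames of `Base g` under `σ`** (`det4_gradient_rho_baseReflection`): with
  `L = dσ^{amb}`, `n = ∇rho (a)`, `n' = ∇rho (σ a)` the hypothesis `⟪n', L u⟫ = ⟪n, u⟫` is the chain rule
  for `rho ∘ σ^{amb} = rho` near the base, and `det L = -1` (V3): the sign of `det4 (∇rho, ·)` of a
  tangent frame is REVERSED.  In the vocabulary of S2 (`ambientC`, `IsPosBdryFrame`; `ambientC h a v =
  ambient g a v`, `ambientC_eq_ambient`): a NEGATIVE tangent frame `v` at an unsurgered boundary point `a`
  of a presentation `q` becomes the POSITIVE frame `dσ(v)` at `σ a` of the transported presentation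
  `(q i).transport σ` (`isPosBdryFrame_transport_baseReflection`, registered as
  `helper_isPosBdryFrame_baseReflection`).

Everything is proved; no named facts, no `sorry`.

## References
* R. İ. Baykur, *Kähler decomposition of 4-manifolds*, AGT 6 (2006), §2.3 and proof of Thm. 5.1
  (`∂X₊ = ∂(−X₋)` as oriented manifolds). [Baykur2006]
* J. M. Lee, *Introduction to Smooth Manifolds* (2013), Prop. 15.24 (boundary orientation: outward
  normal first). [LeeSmoothManifolds2013]
-/

noncomputable section

-- the prescribed namespace `Summit.<P>.<Sub>.…` duplicates `SmoothPoincare4` (P = Sub)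
set_option linter.dupNamespace false

open scoped Manifold ContDiff Topology RealInnerProductSpace

namespace Summit.SmoothPoincare4.SmoothPoincare4.Theorems.AcyclicBisectionExists.ModpBraidOrbits

open Set Function Metric Module
open Literature.Topology.FourManifolds Literature.Topology.FourManifolds.HandleAttachingMap
  Literature.Topology.FourManifolds.LefschetzBase Literature.Geometry.Symplectic
  Literature.Geometry.Manifold

/-! ## §1 `det4` is the determinant form of the standard basis of `ℝ⁴` -/

section Det4

/-- Composition of a map with a `4`-vector of vectors. [folklore] -/
theorem comp_vec4 {α β : Type*} (f : α → β) (a b c d : α) :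
    f ∘ ![a, b, c, d] = ![f a, f b, f c, f d] := by
  funext i; fin_cases i <;> rfl

/-- **`det4` is the determinant of the standard basis** applied to the four vectors (rows versus
columns: `det Aᵀ = det A`). [folklore] -/
theorem det4_eq_basis_det (a b c d : EuclideanSpace ℝ (Fin 4)) :
    det4 a b c d = (PiLp.basisFun 2 ℝ (Fin 4)).det ![a, b, c, d] := by
  rw [Basis.det_apply, ← Matrix.det_transpose]
  unfold det4
  congr 1

/-- **A linear map multiplies `det4` by its determinant.** [folklore] -/
theorem det4_map (L : EuclideanSpace ℝ (Fin 4) →ₗ[ℝ] EuclideanSpace ℝ (Fin 4))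
    (a b c d : EuclideanSpace ℝ (Fin 4)) :
    det4 (L a) (L b) (L c) (L d) = LinearMap.det L * det4 a b c d := by
  rw [det4_eq_basis_det, det4_eq_basis_det, ← comp_vec4, Basis.det_comp]

/-- `det4` is additive in its first slot. [folklore] -/
theorem det4_add_left (x y b c d : EuclideanSpace ℝ (Fin 4)) :
    det4 (x + y) b c d = det4 x b c d + det4 y b c d := by
  simp only [det4_eq_basis_det]
  exact ((PiLp.basisFun 2 ℝ (Fin 4)).det : MultilinearMap ℝ (fun _ : Fin 4 => EuclideanSpace ℝ (Fin 4)) ℝ).cons_add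
    ![b, c, d] x y

/-- `det4` is homogeneous in its first slot. [folklore] -/
theorem det4_smul_left (r : ℝ) (x b c d : EuclideanSpace ℝ (Fin 4)) :
    det4 (r • x) b c d = r * det4 x b c d := by
  simp only [det4_eq_basis_det]
  exact ((PiLp.basisFun 2 ℝ (Fin 4)).det : MultilinearMap ℝ (fun _ : Fin 4 => EuclideanSpace ℝ (Fin 4)) ℝ).cons_smul
    ![b, c, d] r x

/-- `det4` is linear in its first slot: finite sums. [folklore] -/
theorem det4_sum_left {κ : Type*} (s : Finset κ) (r : κ → ℝ) (x : κ → EuclideanSpace ℝ (Fin 4))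
    (b c d : EuclideanSpace ℝ (Fin 4)) :
    det4 (∑ i ∈ s, r i • x i) b c d = ∑ i ∈ s, r i * det4 (x i) b c d := by
  classical
  induction s using Finset.induction_on with
  | empty =>
    simp only [Finset.sum_empty]
    simpa using det4_smul_left 0 0 b c d
  | insert i s hi ih =>
    rw [Finset.sum_insert hi, Finset.sum_insert hi, det4_add_left, det4_smul_left, ih]

/-- `det4` vanishes when the first vector repeats the second … [folklore] -/
theorem det4_self_left₁ (b c d : EuclideanSpace ℝ (Fin 4)) : det4 b b c d = 0 := by
  rw [det4_eq_basis_det]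
  exact AlternatingMap.map_eq_zero_of_eq _ _ (show ![b, b, c, d] 0 = ![b, b, c, d] 1 from rfl)
    (by decide)

/-- … the third … [folklore] -/
theorem det4_self_left₂ (b c d : EuclideanSpace ℝ (Fin 4)) : det4 c b c d = 0 := by
  rw [det4_eq_basis_det]
  exact AlternatingMap.map_eq_zero_of_eq _ _ (show ![c, b, c, d] 0 = ![c, b, c, d] 2 from rfl)
    (by decide)

/-- … or the fourth. [folklore] -/
theorem det4_self_left₃ (b c d : EuclideanSpace ℝ (Fin 4)) : det4 d b c d = 0 := by
  rw [det4_eq_basis_det]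
  exact AlternatingMap.map_eq_zero_of_eq _ _ (show ![d, b, c, d] 0 = ![d, b, c, d] 3 from rfl)
    (by decide)

/-- Four vectors with non-zero `det4` span `ℝ⁴`. [folklore] -/
theorem span_eq_top_of_det4_ne_zero {a b c d : EuclideanSpace ℝ (Fin 4)} (h : det4 a b c d ≠ 0) :
    Submodule.span ℝ (Set.range ![a, b, c, d]) = ⊤ := by
  rw [det4_eq_basis_det] at h
  exact (((PiLp.basisFun 2 ℝ (Fin 4)).is_basis_iff_det).2 (isUnit_iff_ne_zero.2 h)).2

end Det4

/-! ## §2 The linear-algebra core: a hyperplane-respecting automorphism and the normal -/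

section Core

/-- **Normals under a hyperplane-respecting linear automorphism.**  Let `L` be a linear automorphism
of `ℝ⁴`, `n ≠ 0`, and `n'` with `⟪n', L u⟫ = ⟪n, u⟫` for all `u` (i.e. `Lᵀ n' = n`: `L` maps the
hyperplane `n^⊥` onto `n'^⊥`); let `V₀, V₁, V₂ ⊥ n` with `det4 (n, V₀, V₁, V₂) ≠ 0`.  Then
`det4 (n', LV₀, LV₁, LV₂) = det L · (‖n'‖² / ‖n‖²) · det4 (n, V₀, V₁, V₂)`: expanding `n'` in the
basis `(Ln, LV₀, LV₁, LV₂)`, only the `Ln`-coefficient `c₀` survives in the (alternating) determinant,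
and pairing the expansion with `n'` gives `‖n'‖² = c₀ ‖n‖²`.  (So the sign of `det4 (normal, frame)`
changes by the sign of `det L`: the transversal direction cannot flip independently.) [folklore] -/
theorem det4_normal_map (L : EuclideanSpace ℝ (Fin 4) →ₗ[ℝ] EuclideanSpace ℝ (Fin 4))
    (hdet : LinearMap.det L ≠ 0) (n n' : EuclideanSpace ℝ (Fin 4)) (V : Fin 3 → EuclideanSpace ℝ (Fin 4))
    (hL : ∀ u, ⟪n', L u⟫ = ⟪n, u⟫) (hn : n ≠ 0) (hV : ∀ k, ⟪n, V k⟫ = 0)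
    (hD : det4 n (V 0) (V 1) (V 2) ≠ 0) :
    det4 n' (L (V 0)) (L (V 1)) (L (V 2)) =
      LinearMap.det L * (‖n'‖ ^ 2 / ‖n‖ ^ 2) * det4 n (V 0) (V 1) (V 2) := by
  -- the image basis `w = (Ln, LV₀, LV₁, LV₂)`
  set w : Fin 4 → EuclideanSpace ℝ (Fin 4) := ![L n, L (V 0), L (V 1), L (V 2)] with hw
  have hLB : det4 (L n) (L (V 0)) (L (V 1)) (L (V 2)) = LinearMap.det L * det4 n (V 0) (V 1) (V 2) :=
    det4_map L n (V 0) (V 1) (V 2)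
  have hspan : Submodule.span ℝ (Set.range w) = ⊤ :=
    span_eq_top_of_det4_ne_zero (by rw [hLB]; exact mul_ne_zero hdet hD)
  -- expand `n'`
  obtain ⟨c, hc⟩ : ∃ c : Fin 4 → ℝ, ∑ i, c i • w i = n' :=
    (Submodule.mem_span_range_iff_exists_fun ℝ).1 (by rw [hspan]; exact Submodule.mem_top)
  -- the determinant picks the `Ln`-coefficient
  have h1 : det4 n' (L (V 0)) (L (V 1)) (L (V 2)) = c 0 * (LinearMap.det L * det4 n (V 0) (V 1) (V 2)) := by
    rw [← hc, det4_sum_left, Fin.sum_univ_four]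
    simp only [hw, Matrix.cons_val_zero, Matrix.cons_val_one, Matrix.cons_val]
    rw [det4_self_left₁, det4_self_left₂, det4_self_left₃, hLB]
    ring
  -- pairing with `n'` picks the same coefficient
  have h2 : ‖n'‖ ^ 2 = c 0 * ‖n‖ ^ 2 := by
    have e : ‖n'‖ ^ 2 = ⟪n', ∑ i, c i • w i⟫ := by rw [hc, real_inner_self_eq_norm_sq]
    rw [e, inner_sum, Fin.sum_univ_four]
    simp only [real_inner_smul_right, hw, Matrix.cons_val_zero, Matrix.cons_val_one, Matrix.cons_val,
      hL, hV, mul_zero, add_zero, real_inner_self_eq_norm_sq]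
  have hn2 : ‖n‖ ^ 2 ≠ 0 := pow_ne_zero 2 (norm_ne_zero_iff.2 hn)
  have hc0 : c 0 = ‖n'‖ ^ 2 / ‖n‖ ^ 2 := by rw [h2]; field_simp
  rw [h1, hc0]
  ring

end Core

/-! ## §3 Boundary frames of `Base g` under the fibred reflection `σ` -/

section Base

variable {g : ℕ}

/-- The gradient pairs to the derivative: `⟪∇f(x), u⟫ = df_x(u)`. [folklore] -/
theorem inner_gradient_eq_fderiv (f : EuclideanSpace ℝ (Fin 4) → ℝ) (x u : EuclideanSpace ℝ (Fin 4)) :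
    ⟪gradient f x, u⟫ = fderiv ℝ f x u := by
  rw [gradient, InnerProductSpace.toDual_symm_apply]

/-- **The chain rule for `rho ∘ σ^{amb} = rho` near the base**: `d rho_{σ p} (dσ^{amb}_p u) = d rho_p u`
for `rho p ≤ 1/4` (the identity holds on the open region `reflRegion g ⊇ Base g`). [folklore] -/
theorem fderiv_rho_comp_baseReflectionAmb {p : EuclideanSpace ℝ (Fin 4)} (hp : rho g p ≤ 1 / 4)
    (u : EuclideanSpace ℝ (Fin 4)) :
    fderiv ℝ (rho g) (baseReflectionAmb g p) (fderiv ℝ (baseReflectionAmb g) p u) = fderiv ℝ (rho g) p u := by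
  have hmem : p ∈ reflRegion g := mem_reflRegion_of_rho_le hp
  have hev : (rho g ∘ baseReflectionAmb g) =ᶠ[𝓝 p] rho g := by
    filter_upwards [(isOpen_reflRegion g).mem_nhds hmem] with q hq
    exact rho_baseReflectionAmb hq
  have hρ : DifferentiableAt ℝ (rho g) (baseReflectionAmb g p) := (contDiff_rho g).differentiable (by simp) _
  have hσ : DifferentiableAt ℝ (baseReflectionAmb g) p :=
    (contDiff_baseReflectionAmb g).differentiable (by simp) _
  have hcomp : fderiv ℝ (rho g ∘ baseReflectionAmb g) p =
      (fderiv ℝ (rho g) (baseReflectionAmb g p)).comp (fderiv ℝ (baseReflectionAmb g) p) :=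
    fderiv_comp p hρ hσ
  have := congrArg (fun T : EuclideanSpace ℝ (Fin 4) →L[ℝ] ℝ => T u) (hev.fderiv_eq.symm.trans hcomp)
  simpa only [ContinuousLinearMap.comp_apply] using this.symm

/-- `⟪∇rho (σ p), dσ^{amb}_p u⟫ = ⟪∇rho (p), u⟫` on the base. [folklore] -/
theorem inner_gradient_rho_baseReflectionAmb {p : EuclideanSpace ℝ (Fin 4)} (hp : rho g p ≤ 1 / 4)
    (u : EuclideanSpace ℝ (Fin 4)) :
    ⟪gradient (rho g) (baseReflectionAmb g p), fderiv ℝ (baseReflectionAmb g) p u⟫ =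
      ⟪gradient (rho g) p, u⟫ := by
  rw [inner_gradient_eq_fderiv, inner_gradient_eq_fderiv, fderiv_rho_comp_baseReflectionAmb hp]

/-- **`∇rho ≠ 0` on `∂ Base g`** (`d rho (ambient x e₀) = -1`, `fderiv_rho_ambient`). [folklore] -/
theorem gradient_rho_ne_zero (x : Base g) (hx : rho g x.1 = 1 / 4) : gradient (rho g) x.1 ≠ 0 := by
  intro h0
  have h1 := fderiv_rho_ambient x hx (EuclideanSpace.single (0 : Fin 4) (1 : ℝ))
  rw [← inner_gradient_eq_fderiv, h0, inner_zero_left, PiLp.single_apply, if_pos rfl] at h1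
  norm_num at h1

/-- **`det4 (∇rho, ·, ·, ·)` of a tangent frame is NEGATED (up to a positive factor) by `dσ^{amb}`.**
For `x ∈ ∂ Base g`, `V₀, V₁, V₂ ∈ ker d rho_x` with `det4 (∇rho x, V) ≠ 0`:
`det4 (∇rho (σ x), dσ V₀, dσ V₁, dσ V₂) = -(‖∇rho (σ x)‖² / ‖∇rho x‖²) · det4 (∇rho x, V₀, V₁, V₂)`
(§2 with `det dσ^{amb} = -1`, V3). [folklore] -/
theorem det4_gradient_rho_baseReflection (x : Base g) (hx : rho g x.1 = 1 / 4)
    (V : Fin 3 → EuclideanSpace ℝ (Fin 4)) (hV : ∀ k, fderiv ℝ (rho g) x.1 (V k) = 0)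
    (hD : det4 (gradient (rho g) x.1) (V 0) (V 1) (V 2) ≠ 0) :
    det4 (gradient (rho g) (baseReflectionAmb g x.1))
        (fderiv ℝ (baseReflectionAmb g) x.1 (V 0)) (fderiv ℝ (baseReflectionAmb g) x.1 (V 1))
        (fderiv ℝ (baseReflectionAmb g) x.1 (V 2)) =
      -(‖gradient (rho g) (baseReflectionAmb g x.1)‖ ^ 2 / ‖gradient (rho g) x.1‖ ^ 2) *
        det4 (gradient (rho g) x.1) (V 0) (V 1) (V 2) := by
  set L : EuclideanSpace ℝ (Fin 4) →L[ℝ] EuclideanSpace ℝ (Fin 4) := fderiv ℝ (baseReflectionAmb g) x.1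
    with hL
  have hdet : LinearMap.det (L : EuclideanSpace ℝ (Fin 4) →ₗ[ℝ] EuclideanSpace ℝ (Fin 4)) = -1 :=
    det_fderiv_baseReflectionAmb_of_rho_le x.2
  have key := det4_normal_map (L : EuclideanSpace ℝ (Fin 4) →ₗ[ℝ] EuclideanSpace ℝ (Fin 4))
    (by rw [hdet]; norm_num) (gradient (rho g) x.1) (gradient (rho g) (baseReflectionAmb g x.1)) V
    (fun u => inner_gradient_rho_baseReflectionAmb x.2 u) (gradient_rho_ne_zero x hx)
    (fun k => by rw [inner_gradient_eq_fderiv, hV k]) hD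
  simp only [ContinuousLinearMap.coe_coe] at key
  rw [key, hdet]
  ring

/-- **Sign form**: a NEGATIVE tangent frame at `x ∈ ∂ Base g` is pushed by `dσ^{amb}` to a POSITIVE
frame at `σ x`. [folklore] -/
theorem det4_gradient_rho_baseReflection_pos (x : Base g) (hx : rho g x.1 = 1 / 4)
    (V : Fin 3 → EuclideanSpace ℝ (Fin 4)) (hV : ∀ k, fderiv ℝ (rho g) x.1 (V k) = 0)
    (hneg : det4 (gradient (rho g) x.1) (V 0) (V 1) (V 2) < 0) :
    0 < det4 (gradient (rho g) (baseReflectionAmb g x.1))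
        (fderiv ℝ (baseReflectionAmb g) x.1 (V 0)) (fderiv ℝ (baseReflectionAmb g) x.1 (V 1))
        (fderiv ℝ (baseReflectionAmb g) x.1 (V 2)) := by
  rw [det4_gradient_rho_baseReflection x hx V hV hneg.ne, neg_mul]
  have hx' : rho g (baseReflection g x).1 = 1 / 4 := by rw [rho_baseReflection]; exact hx
  have h1 : 0 < ‖gradient (rho g) (baseReflectionAmb g x.1)‖ ^ 2 :=
    pow_pos (norm_pos_iff.2 (gradient_rho_ne_zero (baseReflection g x) hx')) 2
  have h2 : 0 < ‖gradient (rho g) x.1‖ ^ 2 := pow_pos (norm_pos_iff.2 (gradient_rho_ne_zero x hx)) 2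
  have h3 : 0 < ‖gradient (rho g) (baseReflectionAmb g x.1)‖ ^ 2 / ‖gradient (rho g) x.1‖ ^ 2 :=
    div_pos h1 h2
  nlinarith [mul_pos h3 (neg_pos.2 hneg)]

end Base

/-! ## §4 In the vocabulary of S2: `ambientC` and `IsPosBdryFrame` under `σ` -/

section PosFrame

variable {g : ℕ} {ι : Type*} [Finite ι]

/-- **`ambientC` is `ambient`**: the ambient reading of a chart vector of the open submanifold
`Base g ∖ ⋃ cores` at `a` is that of `Base g` at `a` (the inclusion of an open submanifold has identity
differential, `OpenSubmanifold.mfderiv_subtype_val`). [folklore] -/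
theorem ambientC_eq_ambient (q : ι → HandleAttachingMap 3 2 (Base g)) (a : ↥(coresComplement q))
    (v : EuclideanSpace ℝ (Fin 4)) : ambientC q a v = ambient g (a : Base g) v := by
  have hincl : MDifferentiableAt (𝓡∂ 4) (𝓡 4) (RegularSublevel.incl (isRegularLevel_rho g)) (a : Base g) :=
    (RegularSublevel.contMDiff_incl _).mdifferentiableAt (by simp)
  have hval : MDifferentiableAt (𝓡∂ 4) (𝓡∂ 4) (Subtype.val : ↥(coresComplement q) → Base g) a :=
    OpenSubmanifold.mdifferentiableAt_subtype_val a
  unfold ambientC ambient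
  rw [show (fun q' : ↥(coresComplement q) => ((q' : Base g).1 : EuclideanSpace ℝ (Fin 4))) =
      RegularSublevel.incl (isRegularLevel_rho g) ∘ (Subtype.val : ↥(coresComplement q) → Base g) from rfl,
    mfderiv_comp a hincl hval, OpenSubmanifold.mfderiv_subtype_val]
  rfl

/-- **ORSEAM frame flip (sub-goal `helper_isPosBdryFrame_baseReflection` below): a NEGATIVE tangent
frame of an unsurgered boundary point becomes a POSITIVE frame of the `σ`-transported presentation.**
For a presentation `q` of handles on `Base g`, an unsurgered boundary point `a`, chart vectors
`v₀, v₁, v₂` tangent to the boundary (`(v k) 0 = 0`) with `det4 (∇rho a, ambientC v) < 0`, the pushed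
vectors `dσ_a (v k)` at the point `σ a` (unsurgered for the transported family `(q i).transport σ`) form
a positive boundary frame: `IsPosBdryFrame`. [cite: Baykur2006, §2.3] -/
theorem isPosBdryFrame_transport_baseReflection (q : ι → HandleAttachingMap 3 2 (Base g))
    (a : ↥(coresComplement q)) (ha : rho g (a : Base g).1 = 1 / 4)
    (v : Fin 3 → EuclideanSpace ℝ (Fin 4)) (hv : ∀ k, v k 0 = 0)
    (hneg : det4 (gradient (rho g) (a : Base g).1) (ambientC q a (v 0)) (ambientC q a (v 1))
      (ambientC q a (v 2)) < 0)
    (ha' : baseReflection g a ∈ coresComplement fun i => (q i).transport (baseReflection g)) :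
    IsPosBdryFrame (fun i => (q i).transport (baseReflection g)) ⟨baseReflection g a, ha'⟩
      fun k => mfderiv (𝓡∂ 4) (𝓡∂ 4) (baseReflection g) (a : Base g) (v k) := by
  unfold IsPosBdryFrame
  simp only [ambientC_eq_ambient] at hneg ⊢
  have hpt : (((⟨baseReflection g a, ha'⟩ : ↥(coresComplement fun i => (q i).transport (baseReflection g))) :
      Base g).1 : EuclideanSpace ℝ (Fin 4)) = baseReflectionAmb g (a : Base g).1 := rfl
  rw [hpt]
  have hamb : ∀ k, ambient g (((⟨baseReflection g a, ha'⟩ :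
      ↥(coresComplement fun i => (q i).transport (baseReflection g))) : Base g))
      (mfderiv (𝓡∂ 4) (𝓡∂ 4) (baseReflection g) (a : Base g) (v k)) =
      fderiv ℝ (baseReflectionAmb g) (a : Base g).1 (ambient g (a : Base g) (v k)) := fun k =>
    ambient_mfderiv_baseReflection (a : Base g) (v k)
  rw [hamb 0, hamb 1, hamb 2]
  exact det4_gradient_rho_baseReflection_pos (a : Base g) ha (fun k => ambient g (a : Base g) (v k))
    (fun k => by rw [fderiv_rho_ambient _ ha, hv k, neg_zero]) hneg

end PosFrame

/-! ## §5 The registered package -/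

/-- **Sub-goal `helper_isPosBdryFrame_baseReflection` of stub `stub_T3_dualPresentation`** (T3 ▸ ORSEAM;
wave 5, lead c5, worker X4): **the ORSEAM frame flip** — for a presentation `q` of `2`-handles on the
cap `Base g`, an unsurgered boundary point `a` and chart vectors `v₀, v₁, v₂` tangent to `∂ Base g`
whose ambient readings form a NEGATIVE frame (`det4 (∇rho a, ambientC v) < 0`), the vectors
`dσ_a (v k)` at `σ a` form a POSITIVE boundary frame (`IsPosBdryFrame`) for the `σ`-transported
presentation `(q i).transport σ`, `σ = baseReflection g` the fibred orientation-reversing involution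
(`det dσ = -1`, `rho ∘ σ = rho`).  One orientation character governs both the page-twisting sign
(SIGN-PIN, `…DualSignPin.lean`) and this frame sign. [cite: Baykur2006, §2.3] -/
theorem helper_isPosBdryFrame_baseReflection : ∀ (g : ℕ) (ι : Type) [Finite ι] (q : ι → Literature.Topology.FourManifolds.HandleAttachingMap 3 2 (Literature.Topology.FourManifolds.LefschetzBase.Base g)) (a : Literature.Topology.FourManifolds.HandleAttachingMap.coresComplement q) (v : Fin 3 → EuclideanSpace ℝ (Fin 4)) (ha' : Summit.SmoothPoincare4.SmoothPoincare4.Theorems.AcyclicBisectionExists.ModpBraidOrbits.baseReflection g a ∈ Literature.Topology.FourManifolds.HandleAttachingMap.coresComplement fun i => (q i).transport (Summit.SmoothPoincare4.SmoothPoincare4.Theorems.AcyclicBisectionExists.ModpBraidOrbits.baseReflection g)), Literature.Topology.FourManifolds.LefschetzBase.rho g (a : Literature.Topology.FourManifolds.LefschetzBase.Base g).1 = 1 / 4 → (∀ k, v k 0 = 0) → Literature.Geometry.Symplectic.det4 (gradient (Literature.Topology.FourManifolds.LefschetzBase.rho g) (a : Literature.Topology.FourManifolds.LefschetzBase.Base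 g).1) (Literature.Geometry.Symplectic.ambientC q a (v 0)) (Literature.Geometry.Symplectic.ambientC q a (v 1)) (Literature.Geometry.Symplectic.ambientC q a (v 2)) < 0 → Literature.Geometry.Symplectic.IsPosBdryFrame (fun i => (q i).transport (Summit.SmoothPoincare4.SmoothPoincare4.Theorems.AcyclicBisectionExists.ModpBraidOrbits.baseReflection g)) ⟨Summit.SmoothPoincare4.SmoothPoincare4.Theorems.AcyclicBisectionExists.ModpBraidOrbits.baseReflection g a, ha'⟩ fun k => mfderiv (𝓡∂ 4) (𝓡∂ 4) (Summit.SmoothPoincare4.SmoothPoincare4.Theorems.AcyclicBisectionExists.ModpBraidOrbits.baseReflection g) (a : Literature.Topology.FourManifolds.LefschetzBase.Base g) (v k) :=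
  fun _ _ _ q a v ha' ha hv hneg => isPosBdryFrame_transport_baseReflection q a ha v hv hneg ha'


end Summit.SmoothPoincare4.SmoothPoincare4.Theorems.AcyclicBisectionExists.ModpBraidOrbits

end
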